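import Summits.BirchSwinnertonDyer.Rank1Residual.P2.CongruentNumberEvenAokiMonskyForms
import HarnessLib

/-!
# Cell `bsd-monsky`: AOKI = MONSKY FOR EVERY NUMBER OF PRIME FACTORS — part 2, the kernel count
# (pure `𝔽₂`-linear algebra; nothing arithmetic asserted)

HONEST FRAMING (cell `bsd-monsky`, run/shared/lean/pub/bsd-monsky/, README §1: ONE theorem on ONE explicit
infinite family of quadratic twists of the congruent number curve at the prime `2`; not "BSD for rank ≤ 1",
nothing at odd primes, nothing booked until the cross-family referee passes the written proof). This file
asserts NO arithmetic fact. In the dictionary of part 1 (`…EvenAokiMonskyForms.lean`: `L = Aᵀ + D_t`,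
`Lᵀ = L + εεᵀ + D_ε`, `Σ_j L_ji = t_i`, `Σ ε = 1`, Monsky's even matrix `M = ( L  D_ε ; D_t  Lᵀ )`, Aoki's
`T₁ = {ε = 0}`, `C = L|_{ι × T₁}` = `Λ_{S₁,T}`, essential space `W`, Gram matrix `G`) it proves THE KERNEL COUNT

  `dim ker M + 2·rank C + rank (w ⬝ G w')_{w, w' ∈ W} = |T₁| + |ι|`

(`finrank_ker_add_two_mul_rank_add_rank_gram`), i.e. `s(n) = dim ker M = (|T₁| − rank Λ_{S₁,T}) +
(dim W − rank ᵗΦGΦ)`; with `|S| = |ι| + 1`, `|T| = |T₁|` and `rank Λ_{S,T} = rank Λ_{S₁,T}` (the row of the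
prime `2` is the sum of the odd rows) this is Aoki's `1 + |S| + |T| − 2 rank Λ_{S,T} − rank ᵗΦGΦ = 2 + s(n)`
— the arithmetic instantiation is the sequel `…EvenAokiMonskyAllPrimes.lean`.

Proof (prover-B g11, companion note HOME/proof/PROOF-B-AOKI-MONSKY.md): project `ker M ∋ (u, v) ↦ u`.
Its kernel is `{v supported on T₁ : Lᵀ v = 0} ≅ ker C` (symmetry of `L` at `T₁`), of dimension
`|T₁| − rank C`. Its image is `{u ∈ W : w ⬝ G u = 0 ∀ w ∈ W}`: for `(u, v) ∈ ker M` the equations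
`L u = D_ε v`, `Lᵀ v = D_t u` give `u ∈ W` and, for `w ∈ W`, `Σ t_i w_i u_i + (L w) ⬝ (L u) =
(L w) ⬝ v + (L w) ⬝ D_ε v = 0`, which is `w ⬝ G u` by the key identity of part 1; conversely for such `u`
the vector `r = D_t u + Lᵀ D_ε L u` is orthogonal to `W` (same identity), hence `r = C y` lies in the
column space of `C` (= annihilator of the left kernel `W`), and `v = ext(y) + D_ε L u` solves the system.
Rank–nullity three times gives the count.

References: [Aoki1999] Thm. 2.2 p. 81 and its proof p. 98; [HeathBrown1994SelmerCongruentII] Appendix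
(Monsky), typescript p. 41 L20–L36.
-/

noncomputable section

open scoped Classical

open Matrix

set_option autoImplicit false

namespace Summit.BirchSwinnertonDyer.Rank1Residual.P2.AokiMonsky

/-! ## §4 The kernel count: `dim ker M + 2 rank Λ|_{S₁ × T₁} + rank (Gram on W) = |T₁| + |S₁|` -/

section KernelCount

variable {ι : Type*} [Fintype ι] [DecidableEq ι] (L : Matrix ι ι (ZMod 2)) (ε t : ι → ZMod 2)

/-- **The kernel count (Aoki = Monsky, linear-algebra core).** Let `L` be a square matrix over
`𝔽₂` with `Lᵀ = L + εεᵀ + D_ε` (quadratic reciprocity for `L = Aᵀ + D_t`), column sums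
`Σ_j L_ji = t_i` (zero row sums of `A`) and `Σ ε = 1` (an odd number of primes `≡ 3 (mod 4)`), and
`M = ( L  D_ε ; D_t  Lᵀ )` (Monsky's even matrix). With `T₁ = {ε = 0}`, `C = L|_{ι × T₁}`,
`W = {u : (u ᵥ* L)_j = 0 ∀ j ∈ T₁}` (Aoki's `v(Sel₀)`) and `G` Aoki's Gram matrix:
`dim ker M + 2·rank C + rank (w ⬝ G w')_{w, w' ∈ W} = |T₁| + |ι|`.
Proof: `ker M ∋ (u, v) ↦ u` has kernel `{v ⊆ T₁ : Lᵀ v = 0} ≅ ker C` and image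
`{u ∈ W : w ⬝ G u = 0 ∀ w ∈ W}` (column space of `C` = annihilator of `W`). [folklore] -/
theorem finrank_ker_add_two_mul_rank_add_rank_gram
    (hLT : ∀ i j, L j i = L i j + ε i * ε j + if i = j then ε i else 0)
    (hcol : ∀ i, ∑ j, L j i = t i) (hodd : ∑ j, ε j = 1)
    (G : Matrix ι ι (ZMod 2))
    (hG : ∀ i l, G i l = (∑ j, ε j * (L i j * L l j)) + (if i = l then t i else 0) +
      (t i * ε l + ε i * t l))
    (Wfin : Finset (ι → ZMod 2)) (hWfin : ∀ u, u ∈ Wfin ↔ ∀ j, ε j = 0 → (u ᵥ* L) j = 0) :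
    Module.finrank (ZMod 2)
        ↥(LinearMap.ker (Matrix.fromBlocks L (Matrix.diagonal ε) (Matrix.diagonal t) Lᵀ).mulVecLin) +
      2 * (L.submatrix id (Subtype.val : {j // ε j = 0} → ι)).rank +
      (Matrix.of fun w w' : ↥Wfin => (w : ι → ZMod 2) ⬝ᵥ (G *ᵥ (w' : ι → ZMod 2))).rank =
      Fintype.card {j // ε j = 0} + Fintype.card ι := by
  -- the objects
  set C : Matrix ι {j // ε j = 0} (ZMod 2) := L.submatrix id (Subtype.val : {j // ε j = 0} → ι)
    with hC
  set M : Matrix (ι ⊕ ι) (ι ⊕ ι) (ZMod 2) :=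
    Matrix.fromBlocks L (Matrix.diagonal ε) (Matrix.diagonal t) Lᵀ with hM
  set Γ : Matrix ↥Wfin ↥Wfin (ZMod 2) :=
    Matrix.of fun w w' : ↥Wfin => (w : ι → ZMod 2) ⬝ᵥ (G *ᵥ (w' : ι → ZMod 2)) with hΓ
  set W : Submodule (ZMod 2) (ι → ZMod 2) := LinearMap.ker Cᵀ.mulVecLin with hWdef
  set K : Submodule (ZMod 2) (ι ⊕ ι → ZMod 2) := LinearMap.ker M.mulVecLin with hKdef
  set B : Matrix ↥Wfin ι (ZMod 2) :=
    Matrix.of fun (w : ↥Wfin) (i : ι) => ((w : ι → ZMod 2) ᵥ* G) i with hBdef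
  set F : (ι ⊕ ι → ZMod 2) →ₗ[ZMod 2] (ι → ZMod 2) :=
    LinearMap.funLeft (ZMod 2) (ZMod 2) (Sum.inl : ι → ι ⊕ ι) with hF
  have hFapp : ∀ x : ι ⊕ ι → ZMod 2, F x = x ∘ Sum.inl := fun x => rfl
  have hsq : ∀ x : ZMod 2, x * x = x := by decide
  -- membership characterisations
  have hvC : ∀ u : ι → ZMod 2, u ᵥ* C = 0 ↔ ∀ j, ε j = 0 → (u ᵥ* L) j = 0 := by
    intro u
    constructor
    · intro h j hj
      have := congr_fun h ⟨j, hj⟩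
      simpa [hC, Matrix.vecMul, dotProduct] using this
    · intro h
      ext ⟨j, hj⟩
      simpa [hC, Matrix.vecMul, dotProduct] using h j hj
  have hW : ∀ u, u ∈ W ↔ ∀ j, ε j = 0 → (u ᵥ* L) j = 0 := by
    intro u
    rw [hWdef, LinearMap.mem_ker, Matrix.mulVecLin_apply, Matrix.mulVec_transpose]
    exact hvC u
  have hWfin' : ∀ u, u ∈ Wfin ↔ u ∈ W := fun u => (hWfin u).trans (hW u).symm
  have hK : ∀ x, x ∈ K ↔ (∀ j, (L *ᵥ (x ∘ Sum.inl)) j + ε j * x (Sum.inr j) = 0) ∧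
      (∀ i, t i * x (Sum.inl i) + (Lᵀ *ᵥ (x ∘ Sum.inr)) i = 0) := by
    intro x
    rw [hKdef, LinearMap.mem_ker, Matrix.mulVecLin_apply, hM, Matrix.fromBlocks_mulVec]
    constructor
    · intro h
      refine ⟨fun j => ?_, fun i => ?_⟩
      · have := congr_fun h (Sum.inl j)
        simpa [Matrix.mulVec_diagonal] using this
      · have := congr_fun h (Sum.inr i)
        simpa [Matrix.mulVec_diagonal] using this
    · rintro ⟨h1, h2⟩
      ext (j | i)
      · simpa [Matrix.mulVec_diagonal] using h1 j
      · simpa [Matrix.mulVec_diagonal] using h2 i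
  have hBapp : ∀ (w : ↥Wfin) (u : ι → ZMod 2), (B *ᵥ u) w = (w : ι → ZMod 2) ⬝ᵥ (G *ᵥ u) := by
    intro w u
    rw [Matrix.dotProduct_mulVec]
    rfl
  have hext : ∀ (y : {j // ε j = 0} → ZMod 2) (i : ι),
      (Lᵀ *ᵥ fun j => if h : ε j = 0 then y ⟨j, h⟩ else 0) i = (C *ᵥ y) i :=
    fun y i => transpose_mulVec_extend L ε hLT y i
  have hεext : ∀ (y : {j // ε j = 0} → ZMod 2) (j : ι),
      ε j * (fun j => if h : ε j = 0 then y ⟨j, h⟩ else 0) j = 0 := by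
    intro y j
    by_cases h : ε j = 0
    · simp [h]
    · simp [h]
  -- (0) rank–nullity for `F` on `K`: `dim K = dim F(K) + dim (K ∩ ker F)`
  have hsplit : Module.finrank (ZMod 2) ↥(K.map F) +
      Module.finrank (ZMod 2) ↥(K ⊓ LinearMap.ker F) = Module.finrank (ZMod 2) ↥K := by
    have hrn := LinearMap.finrank_range_add_finrank_ker (F ∘ₗ K.subtype)
    rw [LinearMap.range_comp, Submodule.range_subtype, LinearMap.ker_comp] at hrn
    have heq : Submodule.comap K.subtype (LinearMap.ker F) =
        Submodule.comap K.subtype (K ⊓ LinearMap.ker F) := by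
      rw [Submodule.comap_inf, Submodule.comap_subtype_self, top_inf_eq]
    rw [heq] at hrn
    rw [← (Submodule.comapSubtypeEquivOfLe (inf_le_left : K ⊓ LinearMap.ker F ≤ K)).finrank_eq]
    exact hrn
  -- (1) `K ∩ ker F ≅ ker C`
  have hvz : ∀ x : ι ⊕ ι → ZMod 2, x ∈ K ⊓ LinearMap.ker F →
      (∀ i, x (Sum.inl i) = 0) ∧ (∀ j, ¬ ε j = 0 → x (Sum.inr j) = 0) ∧
        (fun j : {j // ε j = 0} => x (Sum.inr (j : ι))) ∈ LinearMap.ker C.mulVecLin := by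
    intro x hx
    obtain ⟨hxK, hxF⟩ := Submodule.mem_inf.mp hx
    rw [LinearMap.mem_ker, hFapp] at hxF
    obtain ⟨h1, h2⟩ := (hK x).mp hxK
    have hl : ∀ i, x (Sum.inl i) = 0 := fun i => congr_fun hxF i
    have hv : ∀ j, ¬ ε j = 0 → x (Sum.inr j) = 0 := by
      intro j hj
      have := h1 j
      rw [hxF, Matrix.mulVec_zero, Pi.zero_apply, zero_add] at this
      have h01 : ∀ x : ZMod 2, x = 0 ∨ x = 1 := by decide
      rcases h01 (ε j) with h0 | h0
      · exact absurd h0 hj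
      · rwa [h0, one_mul] at this
    refine ⟨hl, hv, ?_⟩
    rw [LinearMap.mem_ker, Matrix.mulVecLin_apply]
    have hxext : (fun j => if h : ε j = 0 then
        (fun j' : {j // ε j = 0} => x (Sum.inr (j' : ι))) ⟨j, h⟩ else 0) = x ∘ Sum.inr := by
      ext j
      by_cases h : ε j = 0
      · simp [h]
      · simp [h, hv j h]
    ext i
    rw [← hext, hxext, Pi.zero_apply]
    have := h2 i
    rwa [hl i, mul_zero, zero_add] at this
  let e : ↥(K ⊓ LinearMap.ker F) ≃ₗ[ZMod 2] ↥(LinearMap.ker C.mulVecLin) :=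
    { toFun := fun x => ⟨fun j => (x : ι ⊕ ι → ZMod 2) (Sum.inr (j : ι)), (hvz x x.2).2.2⟩
      map_add' := fun x x' => rfl
      map_smul' := fun c x => rfl
      invFun := fun y => ⟨Sum.elim 0 (fun i => if h : ε i = 0 then
          (y : {j // ε j = 0} → ZMod 2) ⟨i, h⟩ else 0), by
        rw [Submodule.mem_inf]
        constructor
        · rw [hK]
          constructor
          · intro j
            rw [Sum.elim_comp_inl, Matrix.mulVec_zero, Pi.zero_apply, zero_add, Sum.elim_inr]
            exact hεext y j
          · intro i
            rw [Sum.elim_inl, Pi.zero_apply, mul_zero, zero_add, Sum.elim_comp_inr, hext]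
            have := y.2
            rw [LinearMap.mem_ker, Matrix.mulVecLin_apply] at this
            exact congr_fun this i
        · rw [LinearMap.mem_ker, hFapp, Sum.elim_comp_inl]⟩
      left_inv := fun x => by
        obtain ⟨hl, hv, -⟩ := hvz x x.2
        apply Subtype.ext
        ext (i | i)
        · simp only [Sum.elim_inl, Pi.zero_apply]
          exact (hl i).symm
        · simp only [Sum.elim_inr]
          by_cases h : ε i = 0
          · simp [h]
          · simp [h, hv i h]
      right_inv := fun y => by
        apply Subtype.ext
        ext j
        simp [j.2] }
  have hb : Module.finrank (ZMod 2) ↥(K ⊓ LinearMap.ker F) =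
      Module.finrank (ZMod 2) ↥(LinearMap.ker C.mulVecLin) := e.finrank_eq
  have hb2 : Module.finrank (ZMod 2) ↥(LinearMap.ker C.mulVecLin) + C.rank =
      Fintype.card {j // ε j = 0} := by
    have h := LinearMap.finrank_range_add_finrank_ker C.mulVecLin
    rw [Module.finrank_pi (ZMod 2)] at h
    rw [Matrix.rank]
    omega
  -- (2) `F(K) = {u ∈ W : w ⬝ G u = 0 ∀ w ∈ W}`
  have ha : K.map F = W ⊓ LinearMap.ker B.mulVecLin := by
    apply le_antisymm
    · rintro _ ⟨x, hxK, rfl⟩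
      rw [hFapp]
      obtain ⟨h1, h2⟩ := (hK x).mp hxK
      have hl : ∀ i, (x ∘ Sum.inl) i = x (Sum.inl i) := fun i => rfl
      have hb' : ∀ j, (L *ᵥ (x ∘ Sum.inl)) j = ε j * x (Sum.inr j) := fun j =>
        CharTwo.add_eq_zero.mp (h1 j)
      have ht' : ∀ i, t i * x (Sum.inl i) = (Lᵀ *ᵥ (x ∘ Sum.inr)) i := fun i =>
        CharTwo.add_eq_zero.mp (h2 i)
      have hu : ∀ j, ε j = 0 → ((x ∘ Sum.inl) ᵥ* L) j = 0 := by
        intro j hj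
        rw [vecMul_apply_eq_mulVec_apply L ε hLT _ hj, hb' j, hj, zero_mul]
      refine Submodule.mem_inf.mpr ⟨(hW _).mpr hu, ?_⟩
      rw [LinearMap.mem_ker, Matrix.mulVecLin_apply]
      ext w
      have hw : ∀ j, ε j = 0 → ((w : ι → ZMod 2) ᵥ* L) j = 0 := (hWfin _).mp w.2
      rw [hBapp, Pi.zero_apply, dotProduct_gram_mulVec_of_memW L ε t hLT hcol hodd G hG hw hu]
      -- `Σ t_i w_i u_i = w ⬝ Lᵀ v = (L w) ⬝ v` and `(L w) ⬝ (L u) = Σ (L w)_j ε_j v_j`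
      have hs1 : ∑ i, t i * ((w : ι → ZMod 2) i * (x ∘ Sum.inl) i) =
          (L *ᵥ (w : ι → ZMod 2)) ⬝ᵥ (x ∘ Sum.inr) := by
        rw [← Matrix.vecMul_transpose, ← Matrix.dotProduct_mulVec]
        simp only [dotProduct]
        exact Finset.sum_congr rfl fun i _ => by rw [hl, ← ht' i]; ring
      rw [hs1]
      simp only [dotProduct, ← Finset.sum_add_distrib]
      refine Finset.sum_eq_zero fun j _ => ?_
      rw [hb' j, Function.comp_apply,
        show (L *ᵥ (w : ι → ZMod 2)) j * x (Sum.inr j) +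
            (L *ᵥ (w : ι → ZMod 2)) j * (ε j * x (Sum.inr j)) =
          ((L *ᵥ (w : ι → ZMod 2)) j + ε j * (L *ᵥ (w : ι → ZMod 2)) j) * x (Sum.inr j) by ring,
        eps_mul_mulVec_apply_of_memW L ε hLT hw j, CharTwo.add_self_eq_zero, zero_mul]
    · intro u hu'
      obtain ⟨huW, huB⟩ := Submodule.mem_inf.mp hu'
      have hu : ∀ j, ε j = 0 → (u ᵥ* L) j = 0 := (hW u).mp huW
      rw [LinearMap.mem_ker, Matrix.mulVecLin_apply] at huB
      -- the right-hand side `r = D_t u + Lᵀ v₂`, `v₂ = D_ε (L u)`, is orthogonal to `W`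
      obtain ⟨y, hy⟩ := exists_mulVec_eq_of_forall_vecMul_eq_zero C
        (fun i => t i * u i + (Lᵀ *ᵥ fun j => ε j * (L *ᵥ u) j) i) (by
          intro w hw0
          have hw : ∀ j, ε j = 0 → (w ᵥ* L) j = 0 := (hvC w).mp hw0
          have hG0 : w ⬝ᵥ (G *ᵥ u) = 0 := by
            rw [← hBapp ⟨w, (hWfin w).mpr hw⟩ u, huB, Pi.zero_apply]
          rw [dotProduct_gram_mulVec_of_memW L ε t hLT hcol hodd G hG hw hu] at hG0
          rw [← hG0]
          simp only [dotProduct, mul_add, Finset.sum_add_distrib]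
          congr 1
          · exact Finset.sum_congr rfl fun i _ => by ring
          · have h := Matrix.dotProduct_mulVec w Lᵀ (fun j => ε j * (L *ᵥ u) j)
            rw [Matrix.vecMul_transpose] at h
            simp only [dotProduct] at h
            rw [h]
            exact Finset.sum_congr rfl fun j _ => by
              rw [eps_mul_mulVec_apply_of_memW L ε hLT hu j])
      refine ⟨Sum.elim u ((fun j => if h : ε j = 0 then y ⟨j, h⟩ else 0) +
        fun j => ε j * (L *ᵥ u) j), ?_, ?_⟩
      · rw [SetLike.mem_coe, hK]
        constructor
        · intro j
          rw [Sum.elim_comp_inl, Sum.elim_inr, Pi.add_apply, mul_add, hεext, zero_add,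
            ← mul_assoc, hsq, eps_mul_mulVec_apply_of_memW L ε hLT hu j,
            CharTwo.add_self_eq_zero]
        · intro i
          rw [Sum.elim_inl, Sum.elim_comp_inr, Matrix.mulVec_add, Pi.add_apply, hext, hy]
          beta_reduce
          rw [← add_assoc, ← add_assoc, CharTwo.add_self_eq_zero, zero_add, CharTwo.add_self_eq_zero]
      · rw [hFapp, Sum.elim_comp_inl]
  -- (3) the three dimension counts
  have h2 : Module.finrank (ZMod 2) ↥W + C.rank = Fintype.card ι :=
    finrank_ker_transpose_add_rank C
  have h3 : Γ.rank + Module.finrank (ZMod 2) ↥(W ⊓ LinearMap.ker B.mulVecLin) =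
      Module.finrank (ZMod 2) ↥W :=
    rank_gram_add_finrank G Wfin W hWfin'
  rw [ha] at hsplit
  omega

end KernelCount



end Summit.BirchSwinnertonDyer.Rank1Residual.P2.AokiMonsky

end
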